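import Summits.QuantumFields.YangMills.Theorems.BalabanUVNodesN16SlotKeyOfSupData
import Summits.QuantumFields.YangMills.Theorems.BalabanUVNodesN16PinnedLooseMatchOfReg910Slot
import Summits.QuantumFields.YangMills.Theorems.BalabanUVNodesN16CaptureWitnesses
import HarnessLib

/-!
# Route «BalabanUVNodes» (K3⁷ `SpineGivenEndpointR13SepCoPH`, stmt-QuantumFields-20544, skeleton v5 941dddb108cbaacf), DAG node N16 = NE3 —
# THE PRODUCER OF v5's THREE N16 CONJUNCTS FROM `h5` AND THE GAUGE-INVARIANT SLOT KEY (dag-n16-e module 47 re-keyed through file 18), and the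
# key's non-vacuity on the flat sector (file 19 of the lineage `pub-ymgap-dag-n16-w1`)

Cell `pub-ymgap`, width seat `pub-ymgap-dag-n16-w1` (director-ym №197 ∕ HUMAN RULING D-0149), generation 7.  `--kind proof --supports
stmt-QuantumFields-20544 --as helper` (count-neutral; proves NO registered stub).  `bears_on: R4∕N16 · edges N05 → N16, N07 → N16`.  THEOREMS ONLY
(0 `def`, 0 `sorry`, standard axioms), BY NAME over dag-n16-e module 47 `…N16PinnedLooseMatchOfReg910Slot.exists_letters_n16HolderAtReading_loose_of_h5_reg910Slot_match`
(p617842-lineage), my file 18 `…N16SlotKeyOfSupData` (`slotKeyBody_of_supKey`, `slotKeyBody_of_regularSupKey`) and my file 8 `…N16CaptureWitnesses`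
(`hol_eq_one_of_isMinimiser_flatCfg`, `regularSup_of_isMinimiser_flatCfg`) — none edited.

WHAT.  dag-n16-e's DischargeTest v6 derives node N16's share of K3⁷ v5's stub-1 witness from TWO displayed in-edges: `stub_h5` (node N05) and the slot key
`stub_reg910Slot F := ∃ G C, RadiiMono ∧ interface ∧ (T9ˢ)(G, C)` (node N07), via module 47.  By file 18 the slot key's body at `C` follows from node N07's
debt in GAUGE-INVARIANT (8)+(10) currency.  §1 composes the two: ★★ `exists_letters_n16HolderAtReading_loose_of_h5_supKey_match` — module 47's conclusion
(letters `ℓ₃`, radius letter `B` with the MATCH row and `(C F).B₃ ≤ B F`, and `N16PinnedLoose 𝔯 ℓ₃ B → N16HolderAtReading 𝔯 β` at every reading) from `h5`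
VERBATIM and, per family, constants `C F` (`(C F).B₃·(C F).a₁ ≤ 1∕64`), a letter `0 ≤ c F ≤ (C F).B₃` and the sup key «covariant plaquette differences of every
`((C F).B₃ε₁)`-class minimiser at an `ε₁`-loose datum are `≤ c F·ε₁·F.L^{−3(k+1)}`»; ★ `…_of_h5_regularSupKey_match` — the same from the `RegularSup` letters
(`2c′ F ≤ (C F).B₃`).  So a DischargeTest v7 may display node N07's stub WITHOUT `G`, cubes or gauges.  §2 non-vacuity (A6 hygiene): at the flat datum the
sup key's conclusion holds for every bound `≥ 0` (`supKey_on_flatCfg`; minimisers there are flat, file 8) and so does the `RegularSup` key (`regularSupKey_on_flatCfg`).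

HONEST FRAMING.  Kernel bookkeeping by name; `h5` and the sup key are DISPLAYED hypotheses (nodes N05 ∕ N07), asserted for no family and NOT proved here;
nothing of Bałaban asserted or refuted; no stub of K3⁷ v5 closed; N16 ∕ N05 ∕ N07 NOT discharged; the skeleton is the planner's and is NOT edited; counts
UNMOVED (typed 28∕28 · discharged 5∕27, A 5∕28); one finite four-torus at fixed ε — NOT ℝ⁴ ∕ infinite volume ∕ OS ∕ mass gap; the YM mass gap (Clay) is NOT
proved by any of this — R4 closes the conditional finite-𝕋⁴ rung `BalabanLadder.UV` only.
-/

set_option autoImplicit false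

open scoped BigOperators Matrix Matrix.Norms.L2Operator
open NormedSpace

namespace Summit.QuantumFields.YangMills.BalabanUVNodes.N16PinnedLooseMatchOfSupKey

open Literature.MathematicalPhysics.QuantumFieldTheory.Balaban1983to89
open Literature.MathematicalPhysics.QuantumFieldTheory.Balaban1983to89.T4Continuum (T4Family)
open B7Prop1Explicit B7Prop2Explicit MatrixLog UnitaryModel
open T4AveragingDeficitWall hiding Site Plaq Bond
open B7Prop3Flat (c3)
open B8LeafModelZd (ZdIdx)
open B8LeafModelZd3 (zdGF3)
open Node00 (NE3Letters₁₁ ne3NperOfRecord₁₁ MatA)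
open Summit.QuantumFields.BalabanUV.T4Continuum
open MinimalActionSandwich (IsMinimiser)
open MinimalActionRate (sfClass)
open MinimalActionRefine (RegularSup)
open AveragingDeficitLatticeH2Prep (fd)
open YMDAG.UVSplit (RateReading₁₃CoPH)
open Summit.QuantumFields.YangMills.BalabanUVNodes.N16PinnedLayer13CoPH (N16PinnedLoose N16LettersEnd N16HolderAtReading)
open Summit.QuantumFields.YangMills.BalabanUVNodes.N16PinnedLooseMatchOfReg910Slot
  (exists_letters_n16HolderAtReading_loose_of_h5_reg910Slot_match)
open Summit.QuantumFields.YangMills.BalabanUVNodes.N16SlotKeyOfSupData (slotKeyBody_of_supKey slotKeyBody_of_regularSupKey)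
open Summit.QuantumFields.YangMills.BalabanUVNodes.N16SlotKeyNormalForm (perSite_of_reg910Slot)
open Summit.QuantumFields.YangMills.BalabanUVNodes.N16H7LooseOfReg910Slot (leafH3sup_loose_of_reg910Slot h7Shape_loose_of_reg910Slot)
open NE3.LeafIndexSockets (LeafH3sup)
open Summit.QuantumFields.YangMills.BalabanUVNodes.N16ExpGaugeOfSupData (covDiff_plaq_le_of_flux)
open RegularSupOfGauge (norm_covGrad_flux_le_of_localGauge)
open AveragingDeficitKDatum (kRem kRem_le')
open MinimalActionDictionary (torusVP RadiiMono cubeM cubeM_slot_le)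
open B11 (Regularity)
open Summit.QuantumFields.YangMills.BalabanUVNodes.N16CaptureWitnesses (hol_eq_one_of_isMinimiser_flatCfg regularSup_of_isMinimiser_flatCfg)
open MinimalActionWitness (flatCfg)

noncomputable section

/-! ## §1 K3⁷ v5's three N16 conjuncts from `h5` and the GAUGE-INVARIANT slot key -/

section Producer

variable {N : ℕ} [NeZero N] {β : ℝ} (hβ0 : 0 ≤ β) (hβ1 : β ≤ 1)
include hβ0 hβ1

/-- ★★ **THE PRODUCER OF K3⁷ v5's THREE N16 CONJUNCTS FROM `h5` AND THE GAUGE-INVARIANT SUP KEY** — module 47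
`exists_letters_n16HolderAtReading_loose_of_h5_reg910Slot_match` with its slot-key binders `(G, hGm, hG, hR)` REPLACED by node N07's debt in
(8)+(10) currency: for every family `F`, constants `C F` with `(C F).B₃·(C F).a₁ ≤ 1∕64`, a letter `0 ≤ c F ≤ (C F).B₃`, and «at every minimiser `U`
over `sfClass ((C F).B₃ε₁) (k+1)` with an `ε₁`-loose datum (`ε₁ ≤ (C F).a₁`), `‖Ad_{U(x,κ)} U(∂p_{x+e_κ;π}) − U(∂p_{x;π})‖ ≤ c F·ε₁·F.L^{−3(k+1)}`»
(file 18 `slotKeyBody_of_supKey`, `F.L ≥ 2` from `F.hL`).  Conclusion VERBATIM module 47's. [cite: Balaban1985Variational, Thm 1 (8)–(10) p.279] [folklore] -/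
theorem exists_letters_n16HolderAtReading_loose_of_h5_supKey_match {g : T4Family → ℝ} (hg : ∀ F, 0 < g F)
    (h5 : ∀ F : T4Family, letI : CStarAlgebra (Matrix (Fin N) (Fin N) ℂ) := {}
      ∃ (len : Site 4 → ℝ) (c₁ c₁' B₁' cP C₂ B₀β : ℝ) (inp : B8.B9Inputs),
        (∀ v : Site 4, 0 < len v → 1 ≤ len v) ∧ (∀ μ : Fin 4, len (e μ) = 1) ∧ 0 < B₁' ∧ 5 * ((4 : ℕ) : ℝ) * F.L * inp.B₀ ≤ B₁' ∧ 0 < c₁' ∧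
        (∀ α₀ α₁ : ℝ, 0 < α₀ → 0 < α₁ → α₀ + α₁ ≤ c₁' →
          α₀ + α₁ ≤ c₁ ∧ C0 4 * (2 * α₀) ≤ 1 / 3 ∧ 4 * α₀ ≤ c2' 4 F.L ∧ 16 * (B₁' * (α₀ + α₁)) ≤ 1 ∧
          Real.exp (4 * (800 * (((4 : ℕ) : ℝ) + 1) ^ 2 * (((4 : ℕ) : ℝ) + 4)) * α₀) * (1 + 8 * (131072 * (((4 : ℕ) : ℝ) + 1) ^ 2) * (B₁' * (α₀ + α₁))) ≤ 2 ∧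
          2 * (B₁' * (α₀ + α₁)) ≤ c3 4 F.L ∧ ((4 : ℕ) : ℝ) * F.L * α₁ ≤ 1 / 8 ∧ α₀ ≤ cP ∧ α₁ ≤ cP ∧ B₁' * (α₀ + α₁) ≤ cP ∧
          2 * (B₁' * (α₀ + α₁)) ^ 2 + 20 * ((4 : ℕ) : ℝ) * α₀ * (B₁' * (α₀ + α₁)) + 2 * C₂ * (B₁' * (α₀ + α₁)) ^ 2 ≤ α₀ + α₁) ∧
        B8.Thm4Body c₁ B₁' (fun i : {i : ZdIdx 4 F.L // (∀ j, i.Ω j = Set.univ) ∧ (∀ m j, i.Λs m j = {_y | j = m}) ∧ (∀ m j, i.Λb m j = {_c | j = m}) ∧ i.η = ((F.L : ℝ)⁻¹) ^ i.k} => (zdGF3 (Matrix (Fin N) (Fin N) ℂ) F.L β len i.1).toGFData) ∧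
        B8.Prop3Body cP 4 (F.L : ℝ) C₂ inp B₀β (fun i : {i : ZdIdx 4 F.L // (∀ j, i.Ω j = Set.univ) ∧ (∀ m j, i.Λs m j = {_y | j = m}) ∧ (∀ m j, i.Λb m j = {_c | j = m}) ∧ i.η = ((F.L : ℝ)⁻¹) ^ i.k} => (zdGF3 (Matrix (Fin N) (Fin N) ℂ) F.L β len i.1).toGFData2))
    (C : T4Family → B11Thm1.Consts) (c : T4Family → ℝ) (hc0 : ∀ F, 0 ≤ c F) (hcB : ∀ F, c F ≤ (C F).B₃)
    (hBa : ∀ F, (C F).B₃ * (C F).a₁ ≤ 1 / 64)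
    (hK : ∀ (F : T4Family) (k : ℕ) (ε₁ : ℝ), 0 < ε₁ → ε₁ ≤ (C F).a₁ → ∀ (V U : Site 4 → Fin 4 → (MatA N)ˣ),
      V ∈ sfClass 4 F.L (ne3NperOfRecord₁₁ F 0 0) ε₁ 0 →
      IsMinimiser 4 (sfClass 4 F.L (ne3NperOfRecord₁₁ F 0 0) ((C F).B₃ * ε₁)) F.L (ne3NperOfRecord₁₁ F 0 0) (k + 1) V U →
        ∀ (x : Site 4) (κ : Fin 4) (π : T4AveragingDeficitWall.Plane 4),
          ‖covGrad U (fun q => ((fhol U q : (MatA N)ˣ) : MatA N)) x κ π‖ ≤ c F * ε₁ / ((F.L : ℝ) ^ (k + 1)) ^ 3) :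
    ∃ (ℓ₃ : T4Family → NE3Letters₁₁) (B : T4Family → ℝ), N16LettersEnd N g ℓ₃ ∧
      (∀ F : T4Family, 0 < B F ∧ (ℓ₃ F).ε / B F ≤ (ℓ₃ F).b) ∧ (∀ F : T4Family, (C F).B₃ ≤ B F) ∧
      ∀ 𝔯 : RateReading₁₃CoPH N, N16PinnedLoose 𝔯 ℓ₃ B → N16HolderAtReading 𝔯 β := by
  have hkey := fun F : T4Family =>
    slotKeyBody_of_supKey (d := 4) (n := Fin N) (N := ne3NperOfRecord₁₁ F 0 0) (by have := F.hL.2; omega) (C F) (hc0 F) (hcB F)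
      (hBa F) (hK F)
  choose G hGm hG hR using hkey
  exact exists_letters_n16HolderAtReading_loose_of_h5_reg910Slot_match hβ0 hβ1 hg h5 hGm hG C hR

/-- ★ **THE SAME FROM `RegularSup`-TYPE REGULARITY OF THE MINIMISERS** (file 18 `slotKeyBody_of_regularSupKey`): «every minimiser over
`sfClass ((C F).B₃ε₁) (k+1)` at an `ε₁`-loose datum is `RegularSup 4 F.L Nper (b F) (c′ F·ε₁) (k+1)`», `0 ≤ c′ F`, `2c′ F ≤ (C F).B₃`,
`(C F).B₃·(C F).a₁ ≤ 1∕64` — the loose-`LeafH3sup` currency of this lineage's files 1–6. [cite: Balaban1985Variational, Thm 1 (8)–(10) p.279] [folklore] -/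
theorem exists_letters_n16HolderAtReading_loose_of_h5_regularSupKey_match {g : T4Family → ℝ} (hg : ∀ F, 0 < g F)
    (h5 : ∀ F : T4Family, letI : CStarAlgebra (Matrix (Fin N) (Fin N) ℂ) := {}
      ∃ (len : Site 4 → ℝ) (c₁ c₁' B₁' cP C₂ B₀β : ℝ) (inp : B8.B9Inputs),
        (∀ v : Site 4, 0 < len v → 1 ≤ len v) ∧ (∀ μ : Fin 4, len (e μ) = 1) ∧ 0 < B₁' ∧ 5 * ((4 : ℕ) : ℝ) * F.L * inp.B₀ ≤ B₁' ∧ 0 < c₁' ∧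
        (∀ α₀ α₁ : ℝ, 0 < α₀ → 0 < α₁ → α₀ + α₁ ≤ c₁' →
          α₀ + α₁ ≤ c₁ ∧ C0 4 * (2 * α₀) ≤ 1 / 3 ∧ 4 * α₀ ≤ c2' 4 F.L ∧ 16 * (B₁' * (α₀ + α₁)) ≤ 1 ∧
          Real.exp (4 * (800 * (((4 : ℕ) : ℝ) + 1) ^ 2 * (((4 : ℕ) : ℝ) + 4)) * α₀) * (1 + 8 * (131072 * (((4 : ℕ) : ℝ) + 1) ^ 2) * (B₁' * (α₀ + α₁))) ≤ 2 ∧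
          2 * (B₁' * (α₀ + α₁)) ≤ c3 4 F.L ∧ ((4 : ℕ) : ℝ) * F.L * α₁ ≤ 1 / 8 ∧ α₀ ≤ cP ∧ α₁ ≤ cP ∧ B₁' * (α₀ + α₁) ≤ cP ∧
          2 * (B₁' * (α₀ + α₁)) ^ 2 + 20 * ((4 : ℕ) : ℝ) * α₀ * (B₁' * (α₀ + α₁)) + 2 * C₂ * (B₁' * (α₀ + α₁)) ^ 2 ≤ α₀ + α₁) ∧
        B8.Thm4Body c₁ B₁' (fun i : {i : ZdIdx 4 F.L // (∀ j, i.Ω j = Set.univ) ∧ (∀ m j, i.Λs m j = {_y | j = m}) ∧ (∀ m j, i.Λb m j = {_c | j = m}) ∧ i.η = ((F.L : ℝ)⁻¹) ^ i.k} => (zdGF3 (Matrix (Fin N) (Fin N) ℂ) F.L β len i.1).toGFData) ∧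
        B8.Prop3Body cP 4 (F.L : ℝ) C₂ inp B₀β (fun i : {i : ZdIdx 4 F.L // (∀ j, i.Ω j = Set.univ) ∧ (∀ m j, i.Λs m j = {_y | j = m}) ∧ (∀ m j, i.Λb m j = {_c | j = m}) ∧ i.η = ((F.L : ℝ)⁻¹) ^ i.k} => (zdGF3 (Matrix (Fin N) (Fin N) ℂ) F.L β len i.1).toGFData2))
    (C : T4Family → B11Thm1.Consts) (b c' : T4Family → ℝ) (hc0 : ∀ F, 0 ≤ c' F) (hcB : ∀ F, 2 * c' F ≤ (C F).B₃)
    (hBa : ∀ F, (C F).B₃ * (C F).a₁ ≤ 1 / 64)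
    (hR : ∀ (F : T4Family) (k : ℕ) (ε₁ : ℝ), 0 < ε₁ → ε₁ ≤ (C F).a₁ → ∀ (V U : Site 4 → Fin 4 → (MatA N)ˣ),
      V ∈ sfClass 4 F.L (ne3NperOfRecord₁₁ F 0 0) ε₁ 0 →
      IsMinimiser 4 (sfClass 4 F.L (ne3NperOfRecord₁₁ F 0 0) ((C F).B₃ * ε₁)) F.L (ne3NperOfRecord₁₁ F 0 0) (k + 1) V U →
        RegularSup 4 F.L (ne3NperOfRecord₁₁ F 0 0) (b F) (c' F * ε₁) (k + 1) U) :
    ∃ (ℓ₃ : T4Family → NE3Letters₁₁) (B : T4Family → ℝ), N16LettersEnd N g ℓ₃ ∧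
      (∀ F : T4Family, 0 < B F ∧ (ℓ₃ F).ε / B F ≤ (ℓ₃ F).b) ∧ (∀ F : T4Family, (C F).B₃ ≤ B F) ∧
      ∀ 𝔯 : RateReading₁₃CoPH N, N16PinnedLoose 𝔯 ℓ₃ B → N16HolderAtReading 𝔯 β := by
  have hkey := fun F : T4Family =>
    slotKeyBody_of_regularSupKey (d := 4) (n := Fin N) (N := ne3NperOfRecord₁₁ F 0 0) (by have := F.hL.2; omega) (C F) (b := b F)
      (hc0 F) (hcB F) (hBa F) (hR F)
  choose G hGm hG hR' using hkey
  exact exists_letters_n16HolderAtReading_loose_of_h5_reg910Slot_match hβ0 hβ1 hg h5 hGm hG C hR'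

end Producer

/-! ## §1b The lineage's loose leaf (files 1–9) from the sup key: `LeafH3sup` on `ε∕B₃`-loose data -/

/-- ★ **THE LOOSE `LeafH3sup` LEAF FROM THE SUP KEY** (file 9 §2 `leafH3sup_loose_of_reg910Slot` ∘ file 18 `slotKeyBody_of_supKey`): under supKey(C, c) with `c ≤ C.B₃`,
`C.B₃·C.a₁ ≤ 1∕64`, `L ≥ 2`, for every `0 < ε ≤ min (C.B₃·C.a₁) (1∕28)` and every `dom`, `LeafH3sup d L N ε ε (16937ε) {V ∈ dom | V ∈ sfClass (ε∕C.B₃) 0}` — the (v′-16)-type row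
node N19 consumes, now keyed on a gauge-invariant hypothesis. [cite: Balaban1985Variational, Thm 1 (8)–(10) p.279] -/
theorem leafH3sup_loose_of_supKey {d : ℕ} {n : Type} [Fintype n] [DecidableEq n] [Nonempty n] {L N : ℕ} (hL : 2 ≤ L)
    (C : B11Thm1.Consts) {c : ℝ} (hc0 : 0 ≤ c) (hcB : c ≤ C.B₃) (hBa : C.B₃ * C.a₁ ≤ 1 / 64)
    (hK : ∀ (k : ℕ) (ε₁ : ℝ), 0 < ε₁ → ε₁ ≤ C.a₁ → ∀ (V U : Site d → Fin d → (Matrix n n ℂ)ˣ), V ∈ sfClass d L N ε₁ 0 →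
      IsMinimiser d (sfClass d L N (C.B₃ * ε₁)) L N (k + 1) V U →
        ∀ (x : Site d) (κ : Fin d) (π : T4AveragingDeficitWall.Plane d),
          ‖covGrad U (fun q => ((fhol U q : (Matrix n n ℂ)ˣ) : Matrix n n ℂ)) x κ π‖ ≤ c * ε₁ / ((L : ℝ) ^ (k + 1)) ^ 3)
    {ε : ℝ} (hε : 0 < ε) (hεa : ε ≤ C.B₃ * C.a₁) (hε28 : ε ≤ 1 / 28) (dom : Set (Site d → Fin d → (Matrix n n ℂ)ˣ)) :
    LeafH3sup d L N ε ε (16937 * ε) {V | V ∈ dom ∧ V ∈ sfClass d L N (ε / C.B₃) 0} := by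
  obtain ⟨G, hGm, hG, hR⟩ := slotKeyBody_of_supKey hL C hc0 hcB hBa hK
  exact leafH3sup_loose_of_reg910Slot (by omega) hGm hG C hR hε hεa hε28 dom

/-- ★ **… AND ITS `h7`-SHAPE** (`∃ C′ ε₀, …`, file 9 §2 `h7Shape_loose_of_reg910Slot`). [cite: Balaban1985Variational, Thm 1 (8)–(10) p.279] -/
theorem h7Shape_loose_of_supKey {d : ℕ} {n : Type} [Fintype n] [DecidableEq n] [Nonempty n] {L N : ℕ} (hL : 2 ≤ L)
    (C : B11Thm1.Consts) {c : ℝ} (hc0 : 0 ≤ c) (hcB : c ≤ C.B₃) (hBa : C.B₃ * C.a₁ ≤ 1 / 64)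
    (hK : ∀ (k : ℕ) (ε₁ : ℝ), 0 < ε₁ → ε₁ ≤ C.a₁ → ∀ (V U : Site d → Fin d → (Matrix n n ℂ)ˣ), V ∈ sfClass d L N ε₁ 0 →
      IsMinimiser d (sfClass d L N (C.B₃ * ε₁)) L N (k + 1) V U →
        ∀ (x : Site d) (κ : Fin d) (π : T4AveragingDeficitWall.Plane d),
          ‖covGrad U (fun q => ((fhol U q : (Matrix n n ℂ)ˣ) : Matrix n n ℂ)) x κ π‖ ≤ c * ε₁ / ((L : ℝ) ^ (k + 1)) ^ 3)
    (dom : Set (Site d → Fin d → (Matrix n n ℂ)ˣ)) :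
    ∃ C' ε₀ : ℝ, 0 ≤ C' ∧ 0 < ε₀ ∧ ∀ ε : ℝ, 0 < ε → ε ≤ ε₀ →
      LeafH3sup d L N ε (C' * ε) (C' * ε) {V | V ∈ dom ∧ V ∈ sfClass d L N (ε / C.B₃) 0} := by
  obtain ⟨G, hGm, hG, hR⟩ := slotKeyBody_of_supKey hL C hc0 hcB hBa hK
  exact h7Shape_loose_of_reg910Slot (by omega) hGm hG C hR dom

/-! ## §2 Non-vacuity: the sup key holds at the flat datum (every radius letter `c ≥ 0`) -/

/-- **THE SUP KEY IS INHABITED ON THE FLAT SECTOR**: at a minimiser over ANY class `sfClass ρ` (any run) with the FLAT datum, every plaquette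
variable is `1` (file 8 `hol_eq_one_of_isMinimiser_flatCfg`), so every covariant plaquette difference vanishes and the key's conclusion holds for
every bound `≥ 0`.  (A6-type partial inhabitant: the key is consistent where its content is absent; says nothing about non-flat data.) [folklore] -/
theorem supKey_on_flatCfg {d : ℕ} {n : Type} [Fintype n] [DecidableEq n] [Nonempty n] {L N k : ℕ} (hL : 1 ≤ L) (hN : 1 ≤ N)
    {ρ : ℝ} (hρ : 0 ≤ ρ) {U : Site d → Fin d → (Matrix n n ℂ)ˣ}
    (hU : IsMinimiser d (sfClass d L N ρ) L N k (flatCfg : Site d → Fin d → (Matrix n n ℂ)ˣ) U) {γ : ℝ} (hγ : 0 ≤ γ)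
    (x : Site d) (κ : Fin d) (π : T4AveragingDeficitWall.Plane d) :
    ‖covGrad U (fun q => ((fhol U q : (Matrix n n ℂ)ˣ) : Matrix n n ℂ)) x κ π‖ ≤ γ := by
  obtain ⟨⟨μ, ν⟩, hμν⟩ := π
  have h1 : ∀ y : Site d, ((fhol U (y, ⟨(μ, ν), hμν⟩) : (Matrix n n ℂ)ˣ) : Matrix n n ℂ) = 1 := fun y => by
    show ((hol U y (plaqWord μ ν) : (Matrix n n ℂ)ˣ) : Matrix n n ℂ) = 1
    rw [hol_eq_one_of_isMinimiser_flatCfg hL hN hρ hU y μ ν (ne_of_lt hμν), Units.val_one]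
  unfold covGrad
  dsimp only
  rw [h1, h1]
  unfold Ad
  rw [mul_one, Units.mul_inv, sub_self, norm_zero]
  exact hγ

/-- **… AND SO IS THE `RegularSup` KEY** (file 8 `regularSup_of_isMinimiser_flatCfg`, restated at the key's letters: any plaquette letter `b ≥ 0`,
gradient letter `c′ε₁` with `c′ ≥ 0`, `ε₁ ≥ 0`). [folklore] -/
theorem regularSupKey_on_flatCfg {d : ℕ} {n : Type} [Fintype n] [DecidableEq n] [Nonempty n] {L N k : ℕ} (hL : 1 ≤ L) (hN : 1 ≤ N)
    {ρ b c' ε₁ : ℝ} (hρ : 0 ≤ ρ) (hb : 0 ≤ b) (hc' : 0 ≤ c') (hε : 0 ≤ ε₁) {U : Site d → Fin d → (Matrix n n ℂ)ˣ}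
    (hU : IsMinimiser d (sfClass d L N ρ) L N k (flatCfg : Site d → Fin d → (Matrix n n ℂ)ˣ) U) :
    RegularSup d L N b (c' * ε₁) k U :=
  regularSup_of_isMinimiser_flatCfg hL hN hρ hb (by positivity) hU

/-! ## §3 The other direction in the same currency: the slot key's per-site data give the sup key back (constants `35·C.B₃` ∕ `70·C.B₃`) -/

/-- Arithmetic of the return trip: `2tu³ + (90(tu)(tu²) + 32(tu²)² + 360(tu)³) ≤ 10·t·u³` for `0 ≤ t ≤ 7∕128`, `0 < u ≤ 1∕2`. [folklore] -/
theorem returnRadius_le {t u : ℝ} (ht0 : 0 ≤ t) (ht : t ≤ 7 / 128) (hu : 0 < u) (hu2 : u ≤ 1 / 2) :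
    2 * (t * u ^ 3) + (90 * (t * u) * (t * u ^ 2) + 32 * (t * u ^ 2) ^ 2 + 360 * (t * u) ^ 3) ≤ 10 * t * u ^ 3 := by
  have hu3 : 0 < u ^ 3 := by positivity
  have e1 : 90 * (t * u) * (t * u ^ 2) + 32 * (t * u ^ 2) ^ 2 + 360 * (t * u) ^ 3
      = (t * u ^ 3) * (90 * t + 32 * t * u + 360 * t ^ 2) := by ring
  rw [e1]
  have h2 : 90 * t + 32 * t * u + 360 * t ^ 2 ≤ 8 := by nlinarith
  nlinarith [mul_nonneg ht0 hu3.le]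

/-- ★ **THE SLOT KEY's PER-SITE DATA ⟹ THE FLUX-GRADIENT SUP LETTER** (pub-balaban's `RegularSupOfGauge.norm_covGrad_flux_le_of_localGauge` BY NAME at the
slot key's radii `(t∕L^{k+1}, t∕L^{2(k+1)}, t∕L^{3(k+1)})`, `t < C.B₃·M_k·ε₁ ≤ (7∕2)C.B₃ε₁`, `C.B₃·C.a₁ ≤ 1∕64`, `L ≥ 2`): every `(C.B₃ε₁)`-class minimiser at an
`ε₁`-loose datum has `‖∇_U F‖ ≤ 35·C.B₃·ε₁·L^{−3(k+1)}`.  With file 18 this closes the loop: (T9♭)(C) and the gauge-invariant keys imply each other up to the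
constants' windows (`c ≤ C.B₃` in, `35·C.B₃` ∕ `70·C.B₃` out). [cite: Balaban1985Variational, Thm 1 (8)–(10) p.279] -/
theorem fluxKey_of_perSite {d : ℕ} {n : Type} [Fintype n] [DecidableEq n] [Nonempty n] {L N : ℕ} (hL : 2 ≤ L)
    (C : B11Thm1.Consts) (hBa : C.B₃ * C.a₁ ≤ 1 / 64)
    (hP : ∀ (k : ℕ) (ε₁ : ℝ), 0 < ε₁ → ε₁ ≤ C.a₁ → ∀ (V U : Site d → Fin d → (Matrix n n ℂ)ˣ), V ∈ sfClass d L N ε₁ 0 →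
      IsMinimiser d (sfClass d L N (C.B₃ * ε₁)) L N (k + 1) V U →
        ∀ x : Site d, ∃ t : ℝ, 0 ≤ t ∧ t < C.B₃ * cubeM L (k + 1) (L ^ (k + 1) - 1 + L ^ (k + 1) + 2) * ε₁ ∧
          ∃ (u : Site d → (Matrix n n ℂ)ˣ) (a : Site d → Fin d → Matrix n n ℂ),
            (∀ z, u z ∈ unitaryUnits (Matrix n n ℂ)) ∧
            (∀ (y : Site d) (τ : Fin d), l1 (y - x) ≤ 2 →
              ((gaugeAct u U y τ : (Matrix n n ℂ)ˣ) : Matrix n n ℂ) = exp (a y τ)) ∧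
            (∀ (y : Site d) (τ : Fin d), l1 (y - x) ≤ 2 → ‖a y τ‖ ≤ t / (L : ℝ) ^ (k + 1)) ∧
            (∀ (y : Site d) (τ i : Fin d), l1 (y - x) ≤ 1 → ‖fd i (fun z => a z τ) y‖ ≤ t / ((L : ℝ) ^ (k + 1)) ^ 2) ∧
            (∀ (τ i l : Fin d), ‖fd i (fd l (fun z => a z τ)) x‖ ≤ t / ((L : ℝ) ^ (k + 1)) ^ 3)) :
    ∀ (k : ℕ) (ε₁ : ℝ), 0 < ε₁ → ε₁ ≤ C.a₁ → ∀ (V U : Site d → Fin d → (Matrix n n ℂ)ˣ), V ∈ sfClass d L N ε₁ 0 →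
      IsMinimiser d (sfClass d L N (C.B₃ * ε₁)) L N (k + 1) V U →
        ∀ (x : Site d) (κ : Fin d) (π : T4AveragingDeficitWall.Plane d),
          ‖covGrad U (flux U) x κ π‖ ≤ 35 * C.B₃ * ε₁ / ((L : ℝ) ^ (k + 1)) ^ 3 := by
  intro k ε₁ hε hεa V U hV hU x κ π
  obtain ⟨hUu, -, hUs⟩ := hU.mem.1
  have hB := C.B₃_pos
  have hBe : C.B₃ * ε₁ ≤ 1 / 64 := (mul_le_mul_of_nonneg_left hεa hB.le).trans hBa
  -- the scale
  set s : ℝ := (L : ℝ) ^ (k + 1) with hs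
  have hL2 : (2 : ℝ) ≤ L := by exact_mod_cast hL
  have hs2 : 2 ≤ s := by
    rw [hs]
    calc (2 : ℝ) = 2 ^ 1 := by norm_num
      _ ≤ (L : ℝ) ^ 1 := by gcongr
      _ ≤ (L : ℝ) ^ (k + 1) := pow_le_pow_right₀ (by linarith) (by omega)
  have hs0 : 0 < s := by linarith
  set u : ℝ := s⁻¹ with hu
  have hu0 : 0 < u := inv_pos.mpr hs0
  have hu2 : u ≤ 1 / 2 := by rw [hu, one_div]; exact inv_anti₀ (by norm_num) hs2
  -- the per-site datum at `x`
  obtain ⟨t, ht0, htlt, w, a, hw, he, h0, h1, h2⟩ := hP k ε₁ hε hεa V U hV hU x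
  have hM := cubeM_slot_le (L := L) (by omega) (k + 1)
  have ht : t ≤ 7 / 2 * (C.B₃ * ε₁) := by
    have : C.B₃ * cubeM L (k + 1) (L ^ (k + 1) - 1 + L ^ (k + 1) + 2) * ε₁ ≤ C.B₃ * (7 / 2) * ε₁ := by
      have hε0 := hε.le; gcongr
    nlinarith
  have ht7 : t ≤ 7 / 128 := by nlinarith
  -- radii in `u`-form
  have e0 : t / (L : ℝ) ^ (k + 1) = t * u := by rw [← hs, hu, div_eq_mul_inv]
  have e1 : t / ((L : ℝ) ^ (k + 1)) ^ 2 = t * u ^ 2 := by rw [← hs, hu, inv_pow, div_eq_mul_inv]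
  have e2 : t / ((L : ℝ) ^ (k + 1)) ^ 3 = t * u ^ 3 := by rw [← hs, hu, inv_pow, div_eq_mul_inv]
  rw [e0] at h0; rw [e1] at h1; rw [e2] at h2
  have hα₀ : t * u ≤ 1 / 8 := by nlinarith
  have hu1 : u ^ 2 ≤ u := by nlinarith
  have hα₁ : t * u ^ 2 ≤ 1 / 8 := by nlinarith [mul_le_mul_of_nonneg_left hu1 ht0]
  -- plaquettes at `x`, `x + e κ` are within `< 1` of `1` (class membership)
  have hpl : ∀ y : Site d, ‖((fhol U (y, π) : (Matrix n n ℂ)ˣ) : Matrix n n ℂ) - 1‖ < 1 := fun y => by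
    obtain ⟨⟨μ, ν⟩, hμν⟩ := π
    have := hUs y μ ν (ne_of_lt hμν)
    have hs1 : 1 ≤ s ^ 2 := one_le_pow₀ (by linarith)
    exact lt_of_le_of_lt (this.trans (div_le_self (by positivity) hs1)) (by linarith)
  have key := norm_covGrad_flux_le_of_localGauge hUu (x := x) (κ := κ) (π := π) (hpl x) (hpl (x + e κ)) (by positivity)
    (by positivity) hα₀ hα₁ hw he h0 h1 h2
  have hk := kRem_le' (α₀ := t * u) (α₁ := t * u ^ 2) (by positivity) (by positivity) hα₀ hα₁
  have hret := returnRadius_le ht0 ht7 hu0 hu2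
  have e3 : 35 * C.B₃ * ε₁ / ((L : ℝ) ^ (k + 1)) ^ 3 = 35 * (C.B₃ * ε₁) * u ^ 3 := by rw [← hs, hu, inv_pow, div_eq_mul_inv]; ring
  rw [e3]
  have hu3 : 0 < u ^ 3 := by positivity
  calc ‖covGrad U (flux U) x κ π‖ ≤ 2 * (t * u ^ 3) + kRem (t * u) (t * u ^ 2) := key
    _ ≤ 2 * (t * u ^ 3) + (90 * (t * u) * (t * u ^ 2) + 32 * (t * u ^ 2) ^ 2 + 360 * (t * u) ^ 3) := by linarith
    _ ≤ 10 * t * u ^ 3 := hret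
    _ ≤ 10 * (7 / 2 * (C.B₃ * ε₁)) * u ^ 3 := by gcongr
    _ = 35 * (C.B₃ * ε₁) * u ^ 3 := by ring

/-- ★ **… AND THE PLAQUETTE-VARIABLE SUP KEY** with `c = 70·C.B₃` (file 17 `covDiff_plaq_le_of_flux`). [cite: Balaban1985Variational, Thm 1 (8)–(10) p.279] -/
theorem supKey_of_perSite {d : ℕ} {n : Type} [Fintype n] [DecidableEq n] [Nonempty n] {L N : ℕ} (hL : 2 ≤ L)
    (C : B11Thm1.Consts) (hBa : C.B₃ * C.a₁ ≤ 1 / 64)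
    (hP : ∀ (k : ℕ) (ε₁ : ℝ), 0 < ε₁ → ε₁ ≤ C.a₁ → ∀ (V U : Site d → Fin d → (Matrix n n ℂ)ˣ), V ∈ sfClass d L N ε₁ 0 →
      IsMinimiser d (sfClass d L N (C.B₃ * ε₁)) L N (k + 1) V U →
        ∀ x : Site d, ∃ t : ℝ, 0 ≤ t ∧ t < C.B₃ * cubeM L (k + 1) (L ^ (k + 1) - 1 + L ^ (k + 1) + 2) * ε₁ ∧
          ∃ (u : Site d → (Matrix n n ℂ)ˣ) (a : Site d → Fin d → Matrix n n ℂ),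
            (∀ z, u z ∈ unitaryUnits (Matrix n n ℂ)) ∧
            (∀ (y : Site d) (τ : Fin d), l1 (y - x) ≤ 2 →
              ((gaugeAct u U y τ : (Matrix n n ℂ)ˣ) : Matrix n n ℂ) = exp (a y τ)) ∧
            (∀ (y : Site d) (τ : Fin d), l1 (y - x) ≤ 2 → ‖a y τ‖ ≤ t / (L : ℝ) ^ (k + 1)) ∧
            (∀ (y : Site d) (τ i : Fin d), l1 (y - x) ≤ 1 → ‖fd i (fun z => a z τ) y‖ ≤ t / ((L : ℝ) ^ (k + 1)) ^ 2) ∧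
            (∀ (τ i l : Fin d), ‖fd i (fd l (fun z => a z τ)) x‖ ≤ t / ((L : ℝ) ^ (k + 1)) ^ 3)) :
    ∀ (k : ℕ) (ε₁ : ℝ), 0 < ε₁ → ε₁ ≤ C.a₁ → ∀ (V U : Site d → Fin d → (Matrix n n ℂ)ˣ), V ∈ sfClass d L N ε₁ 0 →
      IsMinimiser d (sfClass d L N (C.B₃ * ε₁)) L N (k + 1) V U →
        ∀ (x : Site d) (κ : Fin d) (π : T4AveragingDeficitWall.Plane d),
          ‖covGrad U (fun q => ((fhol U q : (Matrix n n ℂ)ˣ) : Matrix n n ℂ)) x κ π‖ ≤ 70 * C.B₃ * ε₁ / ((L : ℝ) ^ (k + 1)) ^ 3 := by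
  intro k ε₁ hε hεa V U hV hU x κ π
  obtain ⟨hUu, -, hUs⟩ := hU.mem.1
  have hB := C.B₃_pos
  have hs1 : (1 : ℝ) ≤ ((L : ℝ) ^ (k + 1)) ^ 2 := one_le_pow₀ (one_le_pow₀ (by exact_mod_cast (by omega : 1 ≤ L)))
  have hα4 : C.B₃ * ε₁ / ((L : ℝ) ^ (k + 1)) ^ 2 ≤ 1 / 4 := by
    have hBe : C.B₃ * ε₁ ≤ 1 / 64 := (mul_le_mul_of_nonneg_left hεa hB.le).trans hBa
    exact (div_le_self (by positivity) hs1).trans (by linarith)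
  have h := covDiff_plaq_le_of_flux hUu hα4 hUs (fluxKey_of_perSite hL C hBa hP k ε₁ hε hεa V U hV hU) x κ π
  rw [show 70 * C.B₃ * ε₁ / ((L : ℝ) ^ (k + 1)) ^ 3 = 2 * (35 * C.B₃ * ε₁ / ((L : ℝ) ^ (k + 1)) ^ 3) by ring]
  exact h

/-- ★★ **THE SLOT KEY's BODY ⟹ THE SUP KEY** (`c = 70·C.B₃`): from «∃ G, RadiiMono ∧ interface ∧ (T9ˢ)(G, C)» (file 12 `perSite_of_reg910Slot`) — together with file 18
`slotKeyBody_of_supKey` the two displays of node N07's debt imply each other up to the constants' windows. [cite: Balaban1985Variational, Thm 1 (8)–(10) p.279] -/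
theorem supKey_of_slotKeyBody {d : ℕ} {n : Type} [Fintype n] [DecidableEq n] [Nonempty n] {L N : ℕ} (hL : 2 ≤ L)
    (C : B11Thm1.Consts) (hBa : C.B₃ * C.a₁ ≤ 1 / 64)
    (hkey : ∃ G : (Site d → Fin d → (Matrix n n ℂ)ˣ) → Site d → ℕ → ℝ → ℝ → ℝ → Prop,
      RadiiMono d G ∧
      (∀ (U : Site d → Fin d → (Matrix n n ℂ)ˣ) (x : Site d) (K : ℕ) (α₀ α₁ α₂ : ℝ), 2 ≤ K → G U x K α₀ α₁ α₂ →
        ∃ (u : Site d → (Matrix n n ℂ)ˣ) (a : Site d → Fin d → Matrix n n ℂ),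
          (∀ z, u z ∈ unitaryUnits (Matrix n n ℂ)) ∧
          (∀ (y : Site d) (τ : Fin d), l1 (y - x) ≤ 2 → ((gaugeAct u U y τ : (Matrix n n ℂ)ˣ) : Matrix n n ℂ) = exp (a y τ)) ∧
          (∀ (y : Site d) (τ : Fin d), l1 (y - x) ≤ 2 → ‖a y τ‖ ≤ α₀) ∧
          (∀ (y : Site d) (τ i : Fin d), l1 (y - x) ≤ 1 → ‖fd i (fun z => a z τ) y‖ ≤ α₁) ∧
          (∀ (τ i l : Fin d), ‖fd i (fd l (fun z => a z τ)) x‖ ≤ α₂)) ∧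
      (∀ (k : ℕ) (ε₁ : ℝ), 0 < ε₁ → ε₁ ≤ C.a₁ → ∀ (V U : Site d → Fin d → (Matrix n n ℂ)ˣ), V ∈ sfClass d L N ε₁ 0 →
        IsMinimiser d (sfClass d L N (C.B₃ * ε₁)) L N (k + 1) V U →
          ∀ x : Site d, Regularity (torusVP d L N G (k + 1)) C.B₃ C.B₄ ε₁ U (x, L ^ (k + 1) - 1 + L ^ (k + 1) + 2))) :
    ∀ (k : ℕ) (ε₁ : ℝ), 0 < ε₁ → ε₁ ≤ C.a₁ → ∀ (V U : Site d → Fin d → (Matrix n n ℂ)ˣ), V ∈ sfClass d L N ε₁ 0 →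
      IsMinimiser d (sfClass d L N (C.B₃ * ε₁)) L N (k + 1) V U →
        ∀ (x : Site d) (κ : Fin d) (π : T4AveragingDeficitWall.Plane d),
          ‖covGrad U (fun q => ((fhol U q : (Matrix n n ℂ)ˣ) : Matrix n n ℂ)) x κ π‖ ≤ 70 * C.B₃ * ε₁ / ((L : ℝ) ^ (k + 1)) ^ 3 := by
  obtain ⟨G, -, hG, hR⟩ := hkey
  exact supKey_of_perSite hL C hBa (perSite_of_reg910Slot (by omega) hG C hR)

/-! ## §4 The sup key is GAUGE INVARIANT (so it reads the same in any convention of the (42)-objects related by a site gauge) -/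

/-- Plaquette variables transform by conjugation at the corner: `U^g(∂p_{y;π}) = g(y)·U(∂p_{y;π})·g(y)⁻¹` ([Balaban1985Averaging] (8)–(9), `hol_gaugeAct_closed`).
[cite: Balaban1985Averaging, (8)–(9) p.18] -/
theorem fhol_gaugeAct {d : ℕ} {n : Type} [Fintype n] [DecidableEq n] (g : Site d → (Matrix n n ℂ)ˣ) (U : Site d → Fin d → (Matrix n n ℂ)ˣ)
    (y : Site d) (π : T4AveragingDeficitWall.Plane d) : fhol (gaugeAct g U) (y, π) = g y * fhol U (y, π) * (g y)⁻¹ := by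
  unfold fhol
  exact hol_gaugeAct_closed g U y _ (disp_plaqWord _ _)

/-- **THE COVARIANT PLAQUETTE DIFFERENCE IS GAUGE COVARIANT**: `∇_{U^g} U^g(∂·) (x,κ;π) = Ad_{g(x)} (∇_U U(∂·) (x,κ;π))`. [folklore] -/
theorem covGrad_fhol_gaugeAct {d : ℕ} {n : Type} [Fintype n] [DecidableEq n] (g : Site d → (Matrix n n ℂ)ˣ) (U : Site d → Fin d → (Matrix n n ℂ)ˣ)
    (x : Site d) (κ : Fin d) (π : T4AveragingDeficitWall.Plane d) :
    covGrad (gaugeAct g U) (fun q => ((fhol (gaugeAct g U) q : (Matrix n n ℂ)ˣ) : Matrix n n ℂ)) x κ π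
      = Ad (g x) (covGrad U (fun q => ((fhol U q : (Matrix n n ℂ)ˣ) : Matrix n n ℂ)) x κ π) := by
  unfold covGrad Ad
  dsimp only
  rw [fhol_gaugeAct, fhol_gaugeAct]
  have h1 : (gaugeAct g U x κ * (g (x + e κ) * fhol U (x + e κ, π) * (g (x + e κ))⁻¹) * (gaugeAct g U x κ)⁻¹ : (Matrix n n ℂ)ˣ)
      = g x * (U x κ * fhol U (x + e κ, π) * (U x κ)⁻¹) * (g x)⁻¹ := by
    unfold gaugeAct; group
  have h2 : ((gaugeAct g U x κ : (Matrix n n ℂ)ˣ) : Matrix n n ℂ) * ((g (x + e κ) * fhol U (x + e κ, π) * (g (x + e κ))⁻¹ : (Matrix n n ℂ)ˣ) : Matrix n n ℂ)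
        * (((gaugeAct g U x κ)⁻¹ : (Matrix n n ℂ)ˣ) : Matrix n n ℂ)
      = ((g x : (Matrix n n ℂ)ˣ) : Matrix n n ℂ) * (((U x κ : (Matrix n n ℂ)ˣ) : Matrix n n ℂ) * ((fhol U (x + e κ, π) : (Matrix n n ℂ)ˣ) : Matrix n n ℂ)
        * (((U x κ)⁻¹ : (Matrix n n ℂ)ˣ) : Matrix n n ℂ)) * (((g x)⁻¹ : (Matrix n n ℂ)ˣ) : Matrix n n ℂ) := by
    have := congrArg (fun w : (Matrix n n ℂ)ˣ => (w : Matrix n n ℂ)) h1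
    simpa only [Units.val_mul] using this
  rw [h2, Units.val_mul, Units.val_mul, mul_sub, sub_mul]

/-- ★ **THE SUP KEY's LETTER IS GAUGE INVARIANT**: for a unitary site gauge `g`, `‖∇_{U^g} U^g(∂·)‖ = ‖∇_U U(∂·)‖` pointwise — the (10)-type debt displayed by files 17–19 does not see the
gauge, hence transfers verbatim across any two presentations of the (42)-objects that differ by a site gauge (cf. dag-n16-w2 `…SlotKeyGaugeQuotient` for the slot key itself). [folklore] -/
theorem norm_covGrad_fhol_gaugeAct {d : ℕ} {n : Type} [Fintype n] [DecidableEq n] [Nonempty n] {g : Site d → (Matrix n n ℂ)ˣ}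
    (hg : ∀ y, g y ∈ unitaryUnits (Matrix n n ℂ)) (U : Site d → Fin d → (Matrix n n ℂ)ˣ) (x : Site d) (κ : Fin d) (π : T4AveragingDeficitWall.Plane d) :
    ‖covGrad (gaugeAct g U) (fun q => ((fhol (gaugeAct g U) q : (Matrix n n ℂ)ˣ) : Matrix n n ℂ)) x κ π‖
      = ‖covGrad U (fun q => ((fhol U q : (Matrix n n ℂ)ˣ) : Matrix n n ℂ)) x κ π‖ := by
  rw [covGrad_fhol_gaugeAct, AveragingDeficitTransport.norm_Ad_of_unitary (hg x)]

end

end Summit.QuantumFields.YangMills.BalabanUVNodes.N16PinnedLooseMatchOfSupKey
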